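import Mathlib.Analysis.SpecialFunctions.Pow.Real
import Mathlib.Analysis.SpecialFunctions.Sqrt
import Mathlib.Tactic.LinearCombination
import Mathlib.Tactic.Positivity
import HarnessLib

/-!
# Margerin's polynomial inequality — the scalar endgame (line `margerin-cone-hamilton-rails`,
# stub `stub_margerinPolynomial` of crux `EntropyRung.ChangGurskyYang`, item stmt-SmoothPoincare4-10834)

After decoupling Hamilton's block triple `(A, B, C)` into the invariants
`p = √(3/2)·‖Å‖/t`, `p_c = √(3/2)·‖C̊‖/t`, `q = √3·‖B‖/t`, `r = √(3/2)·‖(BBᵀ)°‖/‖B‖²`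
(`t = tr A = tr C`; see the companion matrix file), Margerin's fundamental polynomial at `β = 2`
is bounded by `P₂ ≤ −(8/9) t⁴ · F̂(p, p_c, q, r)` with the quartic

  `F̂ = 3p²(1−p) + 3p_c²(1−p_c) + q²(1−q)² + q²(p²+p_c²) + 2q³r² − 3(p+p_c)q²r`,

and the weak-pinching cone `WP ≤ c` is `p² + p_c² + q² ≤ 6c`. This file proves the sharp lower
bound **`F̂ ≥ N(1 − √N)²`**, `N = p² + p_c² + q² ≤ 1` (`r ∈ [0,1]`), i.e. the MARGIN FORM of
Margerin 1998, Prop. 4 on every sub-cone `6c = K < 1`, with explicit margin `(1 − √K)²`; its zero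
set on the closed cone `K = 1` is exactly the two rigid rays (`q = 1`: `S³ × ℝ`, double zero;
`p = 1` or `p_c = 1`: `ℂP²`, `ℂP̄²`), matching Margerin's Prop. 28 and the kernel calibration
`IdeasSketchR1K2.rigidRays_contact`.

Proof architecture (all certificates are exact rational polynomial identities, found by an exact
LP over Handelman products, `kit/handelman_lp.py`, `kit/certs.py` of the lead's folder):
* blow-up `n² = N`: `F̂ = n²(1−n)² + (2+n)(1−n)(p²+p_c²) + S₃` with the homogeneous cubic
  `S₃ = 3p²(n−p) + 3p_c²(n−p_c) + 2q²(n−q) + 2q³r² − 3(p+p_c)q²r` (the inequality on the unit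
  sphere, homogenised);
* `S₃ ≥ 0` by a two-region split in `3(p+p_c)` vs `4q`: completing the square in `r` gives
  `S₃ = E₁ + (q/8)(4qr − 3(p+p_c))²` and `n·E₁` is a nonnegative combination of 12 products of the
  region constraints when `3(p+p_c) ≤ 4q`; the bound `r ≤ 1` gives
  `S₃ = E₂ + (1−r)q²(3(p+p_c) − 4q) + 2q³(1−r)²` and `n·E₂` is a sum of 7 squares-times-signs,
  valid everywhere.

References: C. Margerin, Comm. Anal. Geom. 6 (1998), Part I, Prop. 4, Lemma 5 (pp. 26–29), Prop. 28
(p. 58) [Margerin1998]; R. S. Hamilton, J. Differential Geom. 24 (1986), §6 [Hamilton1986].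
-/

noncomputable section

-- every `Summit.SmoothPoincare4.SmoothPoincare4.…` name repeats the summit = sub-problem segment (D-0017 layout)
set_option linter.dupNamespace false

namespace Summit.SmoothPoincare4.SmoothPoincare4.Theorems.MargerinRails

/-- **Region `3(p+p_c) ≤ 4q` (neck side): `n·E₁ ≥ 0`**, where
`E₁ = 3p²(n−p) + 3p_c²(n−p_c) + 2q²(n−q) − (9/8)q(p+p_c)²` is `S₃` minus the completed square
`(q/8)(4qr − 3(p+p_c))²`. Exact Handelman certificate: `n·E₁` is a combination with positive
rational coefficients of 12 products of `q`, `n − q`, `4q − 3(p+p_c)`, `p + p_c`, `2pp_c` and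
`(p − p_c)²`, modulo `n² = p² + p_c² + q²`. [cite: Margerin1998, Part I, Prop. 4] -/
theorem margerin_nE1_nonneg (p pc q n : ℝ) (hp : 0 ≤ p) (hpc : 0 ≤ pc) (hq : 0 ≤ q) (hn0 : 0 ≤ n)
    (hn : n ^ 2 = p ^ 2 + pc ^ 2 + q ^ 2) (hcase : 3 * (p + pc) ≤ 4 * q) :
    0 ≤ n * (3 * p ^ 2 * (n - p) + 3 * pc ^ 2 * (n - pc) + 2 * q ^ 2 * (n - q)
      - 9 / 8 * q * (p + pc) ^ 2) := by
  have hnq : q ≤ n := by nlinarith [sq_nonneg p, sq_nonneg pc]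
  set A := n - q with hA_def
  set G := 4 * q - 3 * (p + pc) with hG_def
  set s := p + pc with hs_def
  have hA : 0 ≤ A := by rw [hA_def]; linarith
  have hG : 0 ≤ G := by rw [hG_def]; linarith
  have hs : 0 ≤ s := by rw [hs_def]; linarith
  have key : n * (3 * p ^ 2 * (n - p) + 3 * pc ^ 2 * (n - pc) + 2 * q ^ 2 * (n - q)
      - 9 / 8 * q * (p + pc) ^ 2) =
      255 / 176 * (q * A ^ 2 * G) + 7 / 32 * (q * A * G ^ 2) + 457 / 704 * (q * A * (p - pc) ^ 2)
      + 21 / 32 * (q * s * (2 * p * pc)) + 9 / 32 * (q * G * (p - pc) ^ 2) + 183 / 352 * A ^ 4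
      + 645 / 704 * (A ^ 3 * G) + 97 / 704 * (A ^ 2 * G ^ 2) + 873 / 704 * (A ^ 2 * (p - pc) ^ 2)
      + 15 / 256 * (A * s * G ^ 2) + 273 / 1408 * (A * s * (2 * p * pc))
      + 731 / 2816 * (A * G * (p - pc) ^ 2) := by
    rw [hA_def, hG_def, hs_def]
    linear_combination (-417 / 704 * p * q + 1935 / 704 * p * n - 417 / 704 * pc * q + 1935 / 704 * pc * n
      + 477 / 352 * q ^ 2 - 279 / 176 * q * n - 183 / 352 * n ^ 2) * hn
  rw [key]
  positivity

/-- **Everywhere: `n·E₂ ≥ 0`**, where `E₂ = 3p²(n−p) + 3p_c²(n−p_c) + 2q²n − 3(p+p_c)q²` is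
`S₃` at `r = 1`. Exact certificate: `n·E₂` is a sum of seven squares with nonnegative weights
(`(3/8)(p+p_c)²q² + (1/8)q²(p−p_c)² + p²p_c² + 2n²(n−p−p_c)² + n(p+p_c)(n−p−p_c)² +
(1/4)(p²+p_c²)(n−p−p_c)² + (1/4)(n−p−p_c)²(p−p_c)²`), modulo `n² = p² + p_c² + q²` — it vanishes
exactly on the `ℂP²` rays `(p, p_c, q) = (n, 0, 0), (0, n, 0)`. [cite: Margerin1998, Part I, Prop. 4 and Prop. 28] -/
theorem margerin_nE2_nonneg (p pc q n : ℝ) (hp : 0 ≤ p) (hpc : 0 ≤ pc) (hn0 : 0 ≤ n)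
    (hn : n ^ 2 = p ^ 2 + pc ^ 2 + q ^ 2) :
    0 ≤ n * (3 * p ^ 2 * (n - p) + 3 * pc ^ 2 * (n - pc) + 2 * q ^ 2 * n - 3 * (p + pc) * q ^ 2) := by
  set s := p + pc with hs_def
  have hs : 0 ≤ s := by rw [hs_def]; linarith
  have key : n * (3 * p ^ 2 * (n - p) + 3 * pc ^ 2 * (n - pc) + 2 * q ^ 2 * n - 3 * (p + pc) * q ^ 2) =
      3 / 8 * (s ^ 2 * q ^ 2) + 1 / 8 * (q ^ 2 * (p - pc) ^ 2) + (p * pc) ^ 2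
      + 2 * (n ^ 2 * (n - s) ^ 2) + n * s * (n - s) ^ 2 + 1 / 4 * ((p ^ 2 + pc ^ 2) * (n - s) ^ 2)
      + 1 / 4 * ((n - s) ^ 2 * (p - pc) ^ 2) := by
    rw [hs_def]
    linear_combination (1 / 2 * p ^ 2 + 1 / 2 * p * pc + 3 * p * n + 1 / 2 * pc ^ 2 + 3 * pc * n
      - 2 * n ^ 2) * hn
  rw [key]
  positivity

/-- **The homogenised sphere inequality `S₃ ≥ 0`**: for `p, p_c, q ≥ 0`, `n = √(p²+p_c²+q²)` and
`r ∈ [0, 1]`,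
`S₃ = 3p²(n−p) + 3p_c²(n−p_c) + 2q²(n−q) + 2q³r² − 3(p+p_c)q²r ≥ 0` (zero exactly on the neck ray
`p = p_c = 0, r = 0` and the `ℂP²` rays `q = 0, pp_c = 0`). Split at `3(p+p_c) = 4q`: on the neck
side `S₃ = E₁ + (q/8)(4qr − 3(p+p_c))²`, on the other side
`S₃ = E₂ + (1−r)q²(3(p+p_c) − 4q) + 2q³(1−r)²`. [cite: Margerin1998, Part I, Prop. 4] -/
theorem margerin_sphereCubic_nonneg (p pc q n r : ℝ) (hp : 0 ≤ p) (hpc : 0 ≤ pc) (hq : 0 ≤ q)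
    (hn0 : 0 ≤ n) (hn : n ^ 2 = p ^ 2 + pc ^ 2 + q ^ 2) (hr1 : r ≤ 1) :
    0 ≤ 3 * p ^ 2 * (n - p) + 3 * pc ^ 2 * (n - pc) + 2 * q ^ 2 * (n - q) + 2 * q ^ 3 * r ^ 2
      - 3 * (p + pc) * q ^ 2 * r := by
  -- it suffices to prove `0 ≤ n · S₃`: if `n = 0` everything vanishes
  rcases hn0.eq_or_lt with hn00 | hnpos
  · have h0 : p ^ 2 + pc ^ 2 + q ^ 2 = 0 := by rw [← hn, ← hn00]; ring
    have hp0 : p = 0 := by nlinarith [sq_nonneg pc, sq_nonneg q]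
    have hpc0 : pc = 0 := by nlinarith [sq_nonneg p, sq_nonneg q]
    have hq0 : q = 0 := by nlinarith [sq_nonneg p, sq_nonneg pc]
    subst hp0; subst hpc0; subst hq0
    simp
  have hmain : 0 ≤ n * (3 * p ^ 2 * (n - p) + 3 * pc ^ 2 * (n - pc) + 2 * q ^ 2 * (n - q)
      + 2 * q ^ 3 * r ^ 2 - 3 * (p + pc) * q ^ 2 * r) := by
    by_cases hcase : 3 * (p + pc) ≤ 4 * q
    · -- neck side: `S₃ = E₁ + (q/8)(4qr − 3(p+p_c))²`
      have hE1 := margerin_nE1_nonneg p pc q n hp hpc hq hn0 hn hcase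
      have hsq : 0 ≤ n * (q / 8 * (4 * q * r - 3 * (p + pc)) ^ 2) := by positivity
      linarith [hE1, hsq]
    · -- far side: `S₃ = E₂ + (1−r)q²(3(p+p_c) − 4q) + 2q³(1−r)²`, all three nonnegative
      have hcase' : 4 * q < 3 * (p + pc) := lt_of_not_ge hcase
      have hE2 := margerin_nE2_nonneg p pc q n hp hpc hn0 hn
      have h1 : 0 ≤ n * ((1 - r) * q ^ 2 * (3 * (p + pc) - 4 * q)) := by
        have : 0 ≤ 1 - r := by linarith
        have : 0 ≤ 3 * (p + pc) - 4 * q := by linarith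
        positivity
      have h2 : 0 ≤ n * (2 * q ^ 3 * (1 - r) ^ 2) := by positivity
      linarith [hE2, h1, h2]
  nlinarith [hmain, hnpos]

/-- **Blow-up identity + sphere inequality ⇒ the sharp radial lower bound**: with
`N = n² = p² + p_c² + q²`, `n ∈ [0, 1]`, `r ∈ [0, 1]`,
`F̂ := 3p²(1−p) + 3p_c²(1−p_c) + q²(1−q)² + q²(p²+p_c²) + 2q³r² − 3(p+p_c)q²r ≥ N(1−√N)² = n²(1−n)²`
(equality along the neck ray `p = p_c = r = 0` for EVERY `n`: the double zero of Margerin's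
polynomial at `S³ × ℝ`), via `F̂ = n²(1−n)² + (2+n)(1−n)(p²+p_c²) + S₃`.
[cite: Margerin1998, Part I, Prop. 4 and Lemma 5] -/
theorem margerin_fhat_ge_radial (p pc q n r : ℝ) (hp : 0 ≤ p) (hpc : 0 ≤ pc) (hq : 0 ≤ q)
    (hn0 : 0 ≤ n) (hn : n ^ 2 = p ^ 2 + pc ^ 2 + q ^ 2) (hn1 : n ≤ 1) (hr1 : r ≤ 1) :
    n ^ 2 * (1 - n) ^ 2 ≤ 3 * p ^ 2 * (1 - p) + 3 * pc ^ 2 * (1 - pc) + q ^ 2 * (1 - q) ^ 2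
      + q ^ 2 * (p ^ 2 + pc ^ 2) + 2 * q ^ 3 * r ^ 2 - 3 * (p + pc) * q ^ 2 * r := by
  have hS := margerin_sphereCubic_nonneg p pc q n r hp hpc hq hn0 hn hr1
  have key : 3 * p ^ 2 * (1 - p) + 3 * pc ^ 2 * (1 - pc) + q ^ 2 * (1 - q) ^ 2
      + q ^ 2 * (p ^ 2 + pc ^ 2) + 2 * q ^ 3 * r ^ 2 - 3 * (p + pc) * q ^ 2 * r =
      n ^ 2 * (1 - n) ^ 2 + (2 + n) * (1 - n) * (p ^ 2 + pc ^ 2)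
      + (3 * p ^ 2 * (n - p) + 3 * pc ^ 2 * (n - pc) + 2 * q ^ 2 * (n - q) + 2 * q ^ 3 * r ^ 2
        - 3 * (p + pc) * q ^ 2 * r) := by
    linear_combination (-q ^ 2 - n ^ 2 + 2 * n - 1) * hn
  have hmid : 0 ≤ (2 + n) * (1 - n) * (p ^ 2 + pc ^ 2) := by
    have : 0 ≤ 1 - n := by linarith
    positivity
  rw [key]
  linarith

/-- **Margin form on the sub-cone `N ≤ K < 1`**: `F̂ ≥ (1 − √K)²·N`, the shape consumed by the line
(`σ(c) = (1 − √(6c))²/2` in `stub_margerinPolynomial`). [cite: Margerin1998, Part I, Prop. 4] -/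
theorem margerin_fhat_ge_margin : ∀ (p pc q r K : ℝ), 0 ≤ p → 0 ≤ pc → 0 ≤ q → r ≤ 1 → K ≤ 1 →
    p ^ 2 + pc ^ 2 + q ^ 2 ≤ K →
    (1 - Real.sqrt K) ^ 2 * (p ^ 2 + pc ^ 2 + q ^ 2) ≤
      3 * p ^ 2 * (1 - p) + 3 * pc ^ 2 * (1 - pc) + q ^ 2 * (1 - q) ^ 2
      + q ^ 2 * (p ^ 2 + pc ^ 2) + 2 * q ^ 3 * r ^ 2 - 3 * (p + pc) * q ^ 2 * r := by
  intro p pc q r K hp hpc hq hr1 hK1 hN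
  set N := p ^ 2 + pc ^ 2 + q ^ 2 with hN_def
  have hNn : 0 ≤ N := by positivity
  set n := Real.sqrt N with hn_def
  have hn0 : 0 ≤ n := Real.sqrt_nonneg _
  have hn : n ^ 2 = p ^ 2 + pc ^ 2 + q ^ 2 := by rw [hn_def, Real.sq_sqrt hNn]
  have hK0 : 0 ≤ K := hNn.trans hN
  have hnK : n ≤ Real.sqrt K := Real.sqrt_le_sqrt hN
  have hK1' : Real.sqrt K ≤ 1 := Real.sqrt_le_one.mpr hK1
  have hn1 : n ≤ 1 := hnK.trans hK1'
  have hrad := margerin_fhat_ge_radial p pc q n r hp hpc hq hn0 hn hn1 hr1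
  -- `(1 − √K)² ≤ (1 − n)²` since `0 ≤ 1 − √K ≤ 1 − n`
  have h1 : (1 - Real.sqrt K) ^ 2 ≤ (1 - n) ^ 2 := by
    have : 0 ≤ 1 - Real.sqrt K := by linarith
    have : 1 - Real.sqrt K ≤ 1 - n := by linarith
    nlinarith
  calc (1 - Real.sqrt K) ^ 2 * N ≤ (1 - n) ^ 2 * N := mul_le_mul_of_nonneg_right h1 hNn
    _ = n ^ 2 * (1 - n) ^ 2 := by rw [hN_def, ← hn]; ring
    _ ≤ _ := hrad

end Summit.SmoothPoincare4.SmoothPoincare4.Theorems.MargerinRails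

end
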